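import Summits.Ventures.CertifiedManyBodySolver.Theses.CovHg1201M19b

/-!
# Ventures/CertifiedManyBodySolver — Theorems/CovHg1201M19bAssembly.lean

The ASSEMBLY item (stmt-Ventures-26188) of the coverage route `CovHg1201M19b` (hubbard-cov-hg1201-1; D-0154 (1)(C) «Hg-1201»,
rung «MOS2-hg1201-M19b»): `PatchLeftEdge → PatchBottom → Hg1201M19b_StiffnessBoxCeiling` is the curried form of the route file's
gate-written deciding theorem `closes` (= `Hg1201M19b_StiffnessBoxCeiling_of_cornerPatch le_rfl` (box-2 p607190) ∘
`ObsStiffnessSeqCeilingAt_on_box_of_bottomEdge_and_leftEdge_targetSlot` with `(p, q, U_A, U_max) = (−27/50, −13/25, 7/2, 44/5)`,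
values `−c`, prices trivial). Candidate proof attached to the item by hubbard-cov-hg1201-ref-1 (AssemblyProof.lean, 2026-08-28T06:41Z);
filed under `Theorems/` by hubbard-cov-hg1201-sdp-1 g1. Nothing about the two cruxes is claimed here: the theorem is CONDITIONAL on them
by construction (an implication), exactly as the item is typed.

HONEST FRAMING: glue only — certified stiffness CEILINGS on a downfolded SCREENING-GRADE box are CONTROL / CALIBRATION + labelled
heuristic (wording class (xx1)); a ceiling never speaks to the presence of superconductivity; not a `T_c` or phase statement; no rung
leaf and no summit statement is proved by this file.
-/

namespace Summit.Ventures.CertifiedManyBodySolver.Theorems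

open Summit.Ventures.CertifiedManyBodySolver.Theses.CovHg1201M19b

/-- The assembly item (stmt-Ventures-26188) of route `CovHg1201M19b` is a free closure of the route's deciding theorem `closes`:
the left-edge bundle and the bottom bundle of the residual corner patch give the registered rung leaf
`Hg1201M19b_StiffnessBoxCeiling`. [cite: ScalapinoWhiteZhang1993, §II] -/
theorem covHg1201M19bAssembly_proof : Assembly := by
  unfold Assembly
  exact fun h₁ h₂ => closes h₁ h₂

end Summit.Ventures.CertifiedManyBodySolver.Theorems
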